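import Mathlib
import HarnessLib
import Literature.MathematicalPhysics.QuantumLattice.GaugeGroups
import Literature.MathematicalPhysics.QuantumFieldTheory.ConstructiveQFTWave0
import Literature.MathematicalPhysics.QuantumFieldTheory.U1GinibreComparison
import Literature.MathematicalPhysics.QuantumFieldTheory.LatticeGaugeProofs
import Literature.MathematicalPhysics.QuantumLattice.HeatKernelGroupMeasureProofs
import Summits.Ventures.LatticeQCDFlow.Exactness.CompactHaar
import Summits.Ventures.LatticeQCDFlow.Scaling.PlaquetteIndependence2D
import Summits.Ventures.LatticeQCDFlow.Scaling.PlaquetteMarginals2D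

/-!
# LatticeQCDFlow / Scaling — two dimensions, `U(1)`: the coupling-sign flip `μ_{−β,L} = (σ·)_* μ_{β,L}` by a maximally frustrated background `σ` (even tori)

HONEST FRAMING: exact (Metropolis-corrected) sampling algorithms for lattice gauge theory; figures of merit are
autocorrelation/cost numbers at stated couplings and volumes; no continuum-physics claim.

Venture `LatticeQCDFlow` (cell pub-lqcd), topic `Scaling`, FANOUT row 30 (lean-1) — OUR WORK, the symmetry that
carries the two-dimensional `U(1)` decorrelation / refutation files (`Scaling/PlaquetteDecorrelationTwoDimU1.lean`,
`Scaling/CorrelatorFloorTwoDimU1.lean`, stated for `β ≥ 0`) to NEGATIVE couplings.  For an abelian gauge group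
the plaquette holonomy is multiplicative under pointwise products of configurations (`plaquetteHolonomy_pointwise_mul`),
so translating by a background `σ` ALL of whose plaquettes equal `−1` negates every plaquette, turns the `U(1)` Wilson
weight at `β` into the one at `−β` up to the constant `e^{−2βL²}`, and preserves product Haar measure:

* `plaquetteHolonomy_pointwise_mul`, `plaquetteHolonomy_pointwise_inv` — (any `d`, abelian `G`) `x ↦ U_x` is a
  group homomorphism in `U` (with the tree's `plaquetteHolonomy_one`);
* `plaquetteHolonomy_mul_of_allNeg` — `(σU)_x = −U_x` when every plaquette of `σ` is `−1`; `allNeg_inv`;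
* **`exists_allNeg`** — on an EVEN torus such a `σ` exists (the staggered background: `−1` on the horizontal links
  of the odd rows; `val_succ_mod_two`: parity alternates along a column, across the seam too);
  **`even_of_allNeg`** — and ONLY on even tori (`∏_x U_x = 1` forces `(−1)^{L²} = 1`): odd tori are genuinely
  frustrated at `β < 0` and are not covered;
* `weight_mul_of_allNeg` — `e^{−βS(σU)} = e^{−2βL²}·e^{+βS(U)}`; `withDensity_map_equiv_eq` — transport of a density
  along a measurable equivalence preserving the base measure; `partitionFunction_ne_zero/_ne_top`;
* **`wilsonMeasure_neg_eq_map_of_allNeg`** — `μ_{−β,L} = (σ·)_* μ_{β,L}`;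
  **`wilsonExpectation_neg_coupling_of_allNeg`** — `⟨F⟩_{−β,L} = ⟨F(σ·)⟩_{β,L}` for every observable `F`;
  **`wilsonExpectation_neg_coupling_plaquettes`** — on an even torus, for every function `F` of the plaquette
  field, `⟨F(U_·)⟩_{−β,L} = ⟨F(−U_·)⟩_{β,L}`.

Elementary; nothing here is cited as a fact; no `def`, no `sorry`.
-/

noncomputable section

namespace Summit.Ventures.LatticeQCDFlow.Theory2.Lattice.TwoDim

open MeasureTheory Literature.MathematicalPhysics.QuantumFieldTheory
open Literature.MathematicalPhysics.QuantumLattice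
open scoped ENNReal

/-! ## §1. Abelian gauge group: the plaquette map is a homomorphism under pointwise products -/

section Abelian

variable {d L : ℕ} {G : Type*} [CommGroup G]

/-- `(σU)_x = σ_x · U_x` (pointwise product of configurations, abelian `G`). [folklore] -/
theorem plaquetteHolonomy_pointwise_mul (σ U : GaugeConfig d L G) (x : Site d L) (i j : Fin d) :
    plaquetteHolonomy (σ * U) x i j = plaquetteHolonomy σ x i j * plaquetteHolonomy U x i j := by
  simp only [plaquetteHolonomy, Pi.mul_apply, mul_inv_rev]
  simp only [mul_assoc, mul_comm, mul_left_comm]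

/-- `(σ⁻¹)_x = (σ_x)⁻¹`. [folklore] -/
theorem plaquetteHolonomy_pointwise_inv (σ : GaugeConfig d L G) (x : Site d L) (i j : Fin d) :
    plaquetteHolonomy σ⁻¹ x i j = (plaquetteHolonomy σ x i j)⁻¹ := by
  refine (inv_eq_of_mul_eq_one_left ?_).symm
  rw [← plaquetteHolonomy_pointwise_mul, inv_mul_cancel, plaquetteHolonomy_one]

end Abelian

/-! ## §2. Maximally frustrated backgrounds of the `U(1)` 2-torus -/

section U1

variable {L : ℕ}

/-- Translating by a background whose plaquettes are all `−1` negates every plaquette. [folklore] -/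
theorem plaquetteHolonomy_mul_of_allNeg {σ : GaugeConfig 2 L Circle}
    (hσ : ∀ x, plaquetteHolonomy σ x 0 1 = -1) (U : GaugeConfig 2 L Circle) (x : Site 2 L) :
    plaquetteHolonomy (σ * U) x 0 1 = -plaquetteHolonomy U x 0 1 := by
  rw [plaquetteHolonomy_pointwise_mul, hσ, neg_one_mul]

/-- The inverse background is all `−1` as well. [folklore] -/
theorem allNeg_inv {σ : GaugeConfig 2 L Circle} (hσ : ∀ x, plaquetteHolonomy σ x 0 1 = -1) (x : Site 2 L) :
    plaquetteHolonomy σ⁻¹ x 0 1 = -1 := by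
  rw [plaquetteHolonomy_pointwise_inv, hσ, ← neg_inv, inv_one]

/-- On an EVEN torus the parity of the row index alternates along a column, across the seam too. [folklore] -/
theorem val_succ_mod_two [NeZero L] (hLe : Even L) (b : ZMod L) :
    ((b + 1).val % 2 = 1) ↔ ¬ (b.val % 2 = 1) := by
  have hval : (b + 1).val = (b.val + 1) % L := by
    rw [ZMod.val_add, ZMod.val_one_eq_one_mod, Nat.add_mod_mod]
  have hb : b.val < L := ZMod.val_lt b
  obtain ⟨k, hk⟩ := hLe
  rcases Nat.lt_or_ge (b.val + 1) L with h | h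
  · rw [hval, Nat.mod_eq_of_lt h]; omega
  · have hb1 : b.val + 1 = L := by omega
    rw [hval, hb1, Nat.mod_self]; omega

/-- **A maximally frustrated background EXISTS on every even torus**: the staggered configuration (`−1` on the
horizontal links of the odd rows, `1` elsewhere) has every plaquette equal to `−1`. [folklore] -/
theorem exists_allNeg [NeZero L] (hLe : Even L) :
    ∃ σ : GaugeConfig 2 L Circle, ∀ x, plaquetteHolonomy σ x 0 1 = -1 := by
  refine ⟨fun e => if e.2 = 0 ∧ (e.1 1).val % 2 = 1 then -1 else 1, fun x => ?_⟩
  have hpar := val_succ_mod_two hLe (x 1)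
  have hshift1 : (x.shift 1) 1 = x 1 + 1 := by simp [Site.shift]
  have hshift0 : (x.shift 0) 1 = x 1 := by simp [Site.shift]
  have h10 : ((1 : Fin 2) = 0) = False := by decide
  unfold plaquetteHolonomy
  simp only [hshift1, hshift0, true_and, h10, false_and, if_false, inv_one, mul_one]
  by_cases hp : (x 1).val % 2 = 1
  · have hq : ¬ ((x 1 + 1).val % 2 = 1) := fun h => (hpar.mp h) hp
    simp only [hp, hq, if_true, if_false, inv_one, mul_one]
  · have hq : (x 1 + 1).val % 2 = 1 := hpar.mpr hp
    simp only [hp, hq, if_true, if_false, one_mul, ← neg_inv, inv_one]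

/-- **… and ONLY on even tori**: `∏_x U_x = 1` (abelian 2-torus) forces `(−1)^{L²} = 1`. [folklore] -/
theorem even_of_allNeg [NeZero L] {σ : GaugeConfig 2 L Circle} (hσ : ∀ x, plaquetteHolonomy σ x 0 1 = -1) :
    Even L := by
  have h := prod_plaquetteHolonomy_eq_one σ
  simp only [hσ, Finset.prod_const, Finset.card_univ, Fintype.card_fun, ZMod.card, Fintype.card_fin] at h
  have hsq : Even (L ^ 2) := (neg_one_pow_eq_one_iff_even (Circle.neg_ne_self 1)).mp h
  exact (Nat.even_pow' two_ne_zero).mp hsq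

/-! ## §3. The Wilson weight and measure under a frustrated translation -/

/-- The sites of `(ℤ/L)²` number `L²`. [folklore] -/
theorem card_site_two [NeZero L] : Fintype.card (Site 2 L) = L ^ 2 := by
  rw [Fintype.card_fun, ZMod.card, Fintype.card_fin]

/-- **The Wilson weight under the flip**: `e^{−βS(σU)} = e^{−2βL²}·e^{−(−β)S(U)}`. [folklore] -/
theorem weight_mul_of_allNeg [NeZero L] {σ : GaugeConfig 2 L Circle} (hσ : ∀ x, plaquetteHolonomy σ x 0 1 = -1)
    (β : ℝ) (U : GaugeConfig 2 L Circle) :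
    ENNReal.ofReal (Real.exp (-β * wilsonAction u1Rep (σ * U))) =
      ENNReal.ofReal (Real.exp (-(2 * β * (L : ℝ) ^ 2))) *
        ENNReal.ofReal (Real.exp (-(-β) * wilsonAction u1Rep U)) := by
  rw [weight_eq_prod_two u1Rep β, weight_eq_prod_two u1Rep (-β)]
  have hfac : ∀ x : Site 2 L,
      ENNReal.ofReal (Real.exp (-(β * (((1 : ℕ) : ℝ) - (u1Rep (plaquetteHolonomy (σ * U) x 0 1)).trace.re)))) =
        ENNReal.ofReal (Real.exp (-(2 * β))) *
          ENNReal.ofReal (Real.exp (-(-β * (((1 : ℕ) : ℝ) - (u1Rep (plaquetteHolonomy U x 0 1)).trace.re)))) := by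
    intro x
    rw [plaquetteHolonomy_mul_of_allNeg hσ, trace_u1Rep_re, trace_u1Rep_re, Circle.coe_neg, Complex.neg_re,
      ← ENNReal.ofReal_mul (Real.exp_pos _).le, ← Real.exp_add]
    congr 1
    push_cast
    ring_nf
  rw [Finset.prod_congr rfl fun x _ => hfac x, Finset.prod_mul_distrib, Finset.prod_const, Finset.card_univ,
    card_site_two, ← ENNReal.ofReal_pow (Real.exp_pos _).le, ← Real.exp_nat_mul]
  congr 2
  push_cast
  ring_nf

/-- Transport of a density along a measurable equivalence preserving the base measure:
`(μ.withDensity w).map e = μ.withDensity (w ∘ e.symm)`. [folklore] -/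
theorem withDensity_map_equiv_eq {α : Type*} [MeasurableSpace α] (μ : Measure α)
    (e : α ≃ᵐ α) (w : α → ℝ≥0∞) (hμ : μ.map e = μ) :
    (μ.withDensity w).map e = μ.withDensity (w ∘ e.symm) := by
  ext s hs
  rw [Measure.map_apply e.measurable hs, withDensity_apply _ (e.measurable hs), withDensity_apply _ hs]
  conv_rhs => rw [← hμ]
  rw [Measure.restrict_map e.measurable hs, lintegral_map_equiv]
  simp only [Function.comp_apply, e.symm_apply_apply]

/-- The partition function of a continuous representation is not zero. [folklore] -/
theorem partitionFunction_ne_zero {d N : ℕ} {G : Type*} [Group G] [TopologicalSpace G] [IsTopologicalGroup G]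
    [CompactSpace G] [MeasurableSpace G] [BorelSpace G] (ρ : G →* Matrix (Fin N) (Fin N) ℂ)
    (hρ : Continuous ρ) [NeZero L] (β : ℝ) : partitionFunction (d := d) (L := L) ρ β ≠ 0 := by
  intro h0
  haveI := isProbabilityMeasure_wilsonMeasure (d := d) (L := L) ρ hρ β
  have h1 : wilsonMeasure (d := d) (L := L) ρ β Set.univ = 1 := measure_univ
  unfold wilsonMeasure at h1
  rw [Measure.smul_apply, smul_eq_mul, show wilsonWeight (d := d) (L := L) ρ β Set.univ =
    partitionFunction (d := d) (L := L) ρ β from rfl, h0, mul_zero] at h1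
  exact zero_ne_one h1

/-- The partition function of a continuous representation is finite. [folklore] -/
theorem partitionFunction_ne_top {d N : ℕ} {G : Type*} [Group G] [TopologicalSpace G] [IsTopologicalGroup G]
    [CompactSpace G] [MeasurableSpace G] [BorelSpace G] (ρ : G →* Matrix (Fin N) (Fin N) ℂ)
    (hρ : Continuous ρ) [NeZero L] (β : ℝ) : partitionFunction (d := d) (L := L) ρ β ≠ ⊤ := by
  intro ht
  haveI := isProbabilityMeasure_wilsonMeasure (d := d) (L := L) ρ hρ β
  have h1 : wilsonMeasure (d := d) (L := L) ρ β Set.univ = 1 := measure_univ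
  unfold wilsonMeasure at h1
  rw [Measure.smul_apply, smul_eq_mul, show wilsonWeight (d := d) (L := L) ρ β Set.univ =
    partitionFunction (d := d) (L := L) ρ β from rfl, ht, ENNReal.inv_top, zero_mul] at h1
  exact zero_ne_one h1

/-- **The flipped Wilson weight**: `(σ·)_* (e^{−βS} Haar^{⊗E}) = e^{−2βL²} · e^{+βS} Haar^{⊗E}`. [folklore] -/
theorem wilsonWeight_map_of_allNeg [NeZero L] {σ : GaugeConfig 2 L Circle}
    (hσ : ∀ x, plaquetteHolonomy σ x 0 1 = -1) (β : ℝ) :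
    (wilsonWeight (d := 2) (L := L) u1Rep β).map (MeasurableEquiv.mulLeft σ) =
      ENNReal.ofReal (Real.exp (-(2 * β * (L : ℝ) ^ 2))) • wilsonWeight (d := 2) (L := L) u1Rep (-β) := by
  unfold wilsonWeight
  rw [withDensity_map_equiv_eq _ (MeasurableEquiv.mulLeft σ) _ (map_mul_left_eq_self _ σ)]
  have hcomp : ((fun U : GaugeConfig 2 L Circle => ENNReal.ofReal (Real.exp (-β * wilsonAction u1Rep U))) ∘
      ⇑(MeasurableEquiv.mulLeft σ).symm) = ENNReal.ofReal (Real.exp (-(2 * β * (L : ℝ) ^ 2))) •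
        fun U => ENNReal.ofReal (Real.exp (-(-β) * wilsonAction u1Rep U)) := by
    funext U
    simp only [Function.comp_apply, Pi.smul_apply, smul_eq_mul, MeasurableEquiv.symm_mulLeft,
      MeasurableEquiv.coe_mulLeft]
    exact weight_mul_of_allNeg (allNeg_inv hσ) β U
  rw [hcomp, withDensity_smul' _ _ ENNReal.ofReal_ne_top]

/-- **THE COUPLING-SIGN FLIP**: `μ_{−β,L} = (σ·)_* μ_{β,L}` for the two-dimensional `U(1)` Wilson measure and any
background `σ` all of whose plaquettes are `−1`. [folklore] -/
theorem wilsonMeasure_neg_eq_map_of_allNeg [NeZero L] {σ : GaugeConfig 2 L Circle}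
    (hσ : ∀ x, plaquetteHolonomy σ x 0 1 = -1) (β : ℝ) :
    wilsonMeasure (d := 2) (L := L) u1Rep (-β) =
      (wilsonMeasure (d := 2) (L := L) u1Rep β).map (MeasurableEquiv.mulLeft σ) := by
  set c : ℝ≥0∞ := ENNReal.ofReal (Real.exp (-(2 * β * (L : ℝ) ^ 2))) with hc
  have hc0 : c ≠ 0 := (ENNReal.ofReal_pos.mpr (Real.exp_pos _)).ne'
  have hct : c ≠ ⊤ := ENNReal.ofReal_ne_top
  have hZ : partitionFunction (d := 2) (L := L) u1Rep β = c * partitionFunction (d := 2) (L := L) u1Rep (-β) := by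
    have h := congrArg (fun ν : Measure (GaugeConfig 2 L Circle) => ν Set.univ) (wilsonWeight_map_of_allNeg hσ β)
    simp only [Measure.map_apply (MeasurableEquiv.mulLeft σ).measurable MeasurableSet.univ, Set.preimage_univ,
      Measure.smul_apply, smul_eq_mul] at h
    exact h
  have hZ0 := partitionFunction_ne_zero (d := 2) (L := L) u1Rep continuous_u1Rep (-β)
  have hZt := partitionFunction_ne_top (d := 2) (L := L) u1Rep continuous_u1Rep (-β)
  unfold wilsonMeasure
  rw [Measure.map_smul, wilsonWeight_map_of_allNeg hσ β, smul_smul, hZ,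
    ENNReal.mul_inv (Or.inl hc0) (Or.inl hct), mul_assoc, mul_comm _ c, ← mul_assoc c⁻¹,
    ENNReal.inv_mul_cancel hc0 hct, one_mul]

/-- **Expectations at `−β` are translated expectations at `β`** (every observable). [folklore] -/
theorem wilsonExpectation_neg_coupling_of_allNeg [NeZero L] {σ : GaugeConfig 2 L Circle}
    (hσ : ∀ x, plaquetteHolonomy σ x 0 1 = -1) (β : ℝ) {V : Type*} [NormedAddCommGroup V]
    [NormedSpace ℝ V] (F : GaugeConfig 2 L Circle → V) :
    wilsonExpectation (d := 2) (L := L) u1Rep (-β) F =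
      wilsonExpectation (d := 2) (L := L) u1Rep β (fun U => F (σ * U)) := by
  simp only [wilsonExpectation]
  rw [wilsonMeasure_neg_eq_map_of_allNeg hσ, integral_map_equiv]
  rfl

/-- **Plaquette observables at `−β` = negated-plaquette observables at `β`** (even torus, every `F`). [folklore] -/
theorem wilsonExpectation_neg_coupling_plaquettes [NeZero L] (hLe : Even L) (β : ℝ) {V : Type*}
    [NormedAddCommGroup V] [NormedSpace ℝ V] (F : (Site 2 L → Circle) → V) :
    wilsonExpectation (d := 2) (L := L) u1Rep (-β) (fun U => F fun x => plaquetteHolonomy U x 0 1) =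
      wilsonExpectation (d := 2) (L := L) u1Rep β (fun U => F fun x => -plaquetteHolonomy U x 0 1) := by
  obtain ⟨σ, hσ⟩ := exists_allNeg (L := L) hLe
  rw [wilsonExpectation_neg_coupling_of_allNeg hσ]
  congr 1
  funext U
  simp only [plaquetteHolonomy_mul_of_allNeg hσ]

end U1

end Summit.Ventures.LatticeQCDFlow.Theory2.Lattice.TwoDim

end
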